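import Summits.ResolutionOfSingularities.ResolutionOfSingularities.Theorems.PurelyInseparableDim4ChartZigzagShape
import Summits.ResolutionOfSingularities.ResolutionOfSingularities.Theorems.PurelyInseparableDim4JointZigzagStep
import HarnessLib

/-!
# Purely inseparable four-folds: the COORDINATE CHILD of a coordinate member — a positive-dimensional successor
# centre, through ANY blowing up, as a member of the joint configuration (brick S3 (c) «joint point∘coordinate chains»,
# part 10 = stage (A) of the tree's v2, cell `res-dim4-pi`; consumes typ-2 g3's 3a/3b/3b⁺/3b⁺⁺)

[OURS · counted 0] (D-0157 DOOR 2; desk WORD #66 (4)(c), #74 (g); frame `PIDim4.TerminationImpliesOrderReduction`,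
S3 (c); host item stmt-ResolutionOfSingularities-16155, helper). Nothing here proves resolution of singularities in
dimension ≥ 4 / characteristic `p` — NOT here, not anywhere in this programme.

In the joint tree (`…JointTree`, p675051) the successors of a coordinate member are POINTS. Here is the device for
POSITIVE-DIMENSIONAL successors: a coordinate member of `(Z, M)` — zigzag chart `Z ←φ— Y —ψ→ 𝔸⁵`, centre `Zc`
reading `𝓘Λ S`, state `s`, the TRANSLATED SHAPE `(idx, cst)` of the boundary on the chart (typ-2's FC-1 datum) — is
blown up (`π : W → Z` ANY blowing up along `Zc`), and a PLAN ENTRY `(j, b, S″)` (`j ∈ S`, `b_j = 0`, `S ⊆ S″`) names the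
next centre `V(z, x_{S″})` at the point `b` of the `x_j`-chart. Then:

* **`coord_child_package`** — the CHILD is again a coordinate member, on `(W, M.transform π Zc)`: a closed set
  `c″ ⊆ W` (typ-2's `closureImage` of the next centre on the zigzag chart of the chart), with
  `IsRegular (vanishingIdeal c″).subscheme`, `HasSNCWith (M.transform π Zc).boundary (vanishingIdeal c″)` (FC-1
  RE-DERIVED: shape propagation `shapeT_transform_zigzag` + `hasSNCWith_comap_of_shapeT_zigzag` +
  `hasSNCWith_globalCentre_zigzag`), a zigzag chart `W ←φ″— Y″ —ψ″→ 𝔸⁵` reading `(z^p + (step p S j b s).F)·𝒪` and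
  `𝓘Λ S″`, covering `c″` and seeing `V(z, x_{S″})`, the propagated shape `(idx₂, cst₂)`, and `c″ ⊆ π⁻¹(parent)`.

With part 6 (`coord_zigzag_step_package`, point successors), part 4 (survival) and typ-2 g3's GROUPING
(`…ChartGrouping`: disjointness / membership criteria for plan entries on the model) this is the step of the MONOTONE
JOINT FOREST (v2 of the tree: coordinate successors with `S ⊆ S″`); the forest induction itself is the next file.
HONEST SCOPE: `S ⊆ S″` only (typ-2's closedness propagation; escaping centres FC-2 excluded); permissibility of `S″` for
the child state is NOT needed for the package (it is needed when the child is blown up). AI-produced formalisation,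
weaker than expert review. bears_on: LADDER-RESOLUTION:D157-DOOR2 (res-dim4-pi · S3 (c) joint v2 (A)).
-/

set_option linter.dupNamespace false -- D-0017: single-problem summit path `Summit.<S>.<S>.…` by design

noncomputable section

open MvPolynomial Finset CategoryTheory AlgebraicGeometry Opposite TopologicalSpace
open AlgebraicGeometry.Scheme.IdealSheafData (ofIdealTop vanishingIdeal)

namespace Summit.ResolutionOfSingularities.ResolutionOfSingularities.Theorems.PIDim4

open Literature.AlgebraicGeometry.Resolution
open Literature.AlgebraicGeometry.Resolution.Hauser2010
open Literature.AlgebraicGeometry.Resolution.AffinePointBlowup (P A γ coord Wtop ξ)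

namespace Equimultiple

section Child

variable {K : Type} [Field K] {p : ℕ} [hp : Fact p.Prime] [CharP K p] [DecidableEq K]
variable {Z Y W : Scheme.{0}} (φ : Y ⟶ Z) [IsOpenImmersion φ] (ψ : Y ⟶ P 4 K) [IsOpenImmersion ψ]
  {π : W ⟶ Z} {S S'' : Finset (Fin 4)} {j : Fin 4} {b : Fin 4 → K}

/-- **THE COORDINATE CHILD PACKAGE.** See the module docstring. Data: `Z` locally Noetherian, `K = K̄` of
characteristic `p`; a coordinate member (`φ`, `ψ`, `Zc` with `Zc.comap φ = (𝓘Λ S).comap ψ`, `M` of multiplicity `p`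
reading `(z^p + s.F)·𝒪`, `p ≤ ord_{(x_S)} s.F`, the chart sees `V(z, x_S)` and `φ(ψ⁻¹V(z, x_S))` is closed,
`HasSNCWith M.boundary Zc`, translated shape `(idx, cst)` of `M.boundary` on the chart); `π` any blowing up along `Zc`;
a plan entry `j ∈ S`, `b` with `b_j = 0`, `S ⊆ S″`. Conclusion: the child member on `W` with all its data.
[cite: BierstoneGrigorievMilmanWlodarczyk2011, Def. 3.1.3 (1)–(2), (4)] [cite: HauserPerlega2019PRIMS, §2]
[cite: GortzWedhorn2020, Prop. 13.91] -/
theorem coord_child_package [IsLocallyNoetherian Z] [IsAlgClosed K] (Zc : Z.IdealSheafData)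
    (hZφ : Zc.comap φ = (AffineCoordBlowup.𝓘Λ 4 K (insert 0 (Fin.succ '' (S : Set (Fin 4))))).comap ψ)
    (hπ : IsBlowup π Zc) (M : MarkedIdeal Z) (hmult : M.mult = p) (s : State K)
    (hM : M.ideal.comap φ = (hypSheaf p s.F).comap ψ) (hperm : (p : ℕ∞) ≤ CentreBlowup.ordAlong S s.F)
    (hsee : (AffineCoordBlowup.CΛ 4 K (insert 0 (Fin.succ '' (S : Set (Fin 4)))) : Set (P 4 K)) ⊆ Set.range ψ)
    (hT : IsClosed (φ '' (ψ ⁻¹' (AffineCoordBlowup.CΛ 4 K (insert 0 (Fin.succ '' (S : Set (Fin 4)))) : Set (P 4 K)))))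
    (hsncZ : HasSNCWith M.boundary Zc) (idx : Z.IdealSheafData → Fin 4) (cst : Z.IdealSheafData → K)
    (hshape : ∀ D ∈ M.boundary,
      ((D.support : Set Z) ∩ φ '' (ψ ⁻¹'
        (AffineCoordBlowup.CΛ 4 K (insert 0 (Fin.succ '' (S : Set (Fin 4)))) : Set (P 4 K)))).Nonempty →
      D.comap φ = (ofIdealTop (Ideal.span {(γ 4 K).symm (X (idx D).succ + C (cst D))})).comap ψ ∧
        (idx D ∈ S → cst D = 0))
    (hinj : ∀ D₁ ∈ M.boundary, ∀ D₂ ∈ M.boundary,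
      ((D₁.support : Set Z) ∩ φ '' (ψ ⁻¹'
        (AffineCoordBlowup.CΛ 4 K (insert 0 (Fin.succ '' (S : Set (Fin 4)))) : Set (P 4 K)))).Nonempty →
      ((D₂.support : Set Z) ∩ φ '' (ψ ⁻¹'
        (AffineCoordBlowup.CΛ 4 K (insert 0 (Fin.succ '' (S : Set (Fin 4)))) : Set (P 4 K)))).Nonempty →
      idx D₁ = idx D₂ → D₁ = D₂)
    (hj : j ∈ S) (hbj : b j = 0) (hsub : S ⊆ S'') :
    ∃ (c'' : Closeds W) (Y'' : Scheme.{0}) (φ'' : Y'' ⟶ W) (ψ'' : Y'' ⟶ P 4 K) (_ : IsOpenImmersion φ'')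
      (_ : IsOpenImmersion ψ''),
      (M.transform π Zc).ideal.comap φ'' = (hypSheaf p (CentreBlowup.step p S j b s).F).comap ψ'' ∧
      (vanishingIdeal c'').comap φ'' =
        (AffineCoordBlowup.𝓘Λ 4 K (insert 0 (Fin.succ '' (S'' : Set (Fin 4))))).comap ψ'' ∧
      (c'' : Set W) ⊆ Set.range φ'' ∧
      (AffineCoordBlowup.CΛ 4 K (insert 0 (Fin.succ '' (S'' : Set (Fin 4)))) : Set (P 4 K)) ⊆ Set.range ψ'' ∧
      Scheme.IsRegular (vanishingIdeal c'').subscheme ∧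
      HasSNCWith (M.transform π Zc).boundary (vanishingIdeal c'') ∧
      (∃ (idx₂ : W.IdealSheafData → Fin 4) (cst₂ : W.IdealSheafData → K),
        (∀ D₂ ∈ (M.transform π Zc).boundary,
          ((D₂.support : Set W) ∩ φ'' '' (ψ'' ⁻¹'
            (AffineCoordBlowup.CΛ 4 K (insert 0 (Fin.succ '' (S'' : Set (Fin 4)))) : Set (P 4 K)))).Nonempty →
          D₂.comap φ'' = (ofIdealTop (Ideal.span {(γ 4 K).symm (X (idx₂ D₂).succ + C (cst₂ D₂))})).comap ψ'' ∧
            (idx₂ D₂ ∈ S'' → cst₂ D₂ = 0)) ∧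
        (∀ D₁ ∈ (M.transform π Zc).boundary, ∀ D₂ ∈ (M.transform π Zc).boundary,
          ((D₁.support : Set W) ∩ φ'' '' (ψ'' ⁻¹'
            (AffineCoordBlowup.CΛ 4 K (insert 0 (Fin.succ '' (S'' : Set (Fin 4)))) : Set (P 4 K)))).Nonempty →
          ((D₂.support : Set W) ∩ φ'' '' (ψ'' ⁻¹'
            (AffineCoordBlowup.CΛ 4 K (insert 0 (Fin.succ '' (S'' : Set (Fin 4)))) : Set (P 4 K)))).Nonempty →
          idx₂ D₁ = idx₂ D₂ → D₁ = D₂)) ∧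
      (c'' : Set W) ⊆ π ⁻¹' (φ '' (ψ ⁻¹'
        (AffineCoordBlowup.CΛ 4 K (insert 0 (Fin.succ '' (S : Set (Fin 4)))) : Set (P 4 K)))) := by
  haveI : PerfectRing K p := PerfectRing.ofSurjective K p fun x => IsAlgClosed.exists_pow_nat_eq x hp.out.pos
  haveI : IsProper π := hπ.isProper
  haveI : IsLocallyNoetherian W := LocallyOfFiniteType.isLocallyNoetherian π
  set C₀ := AffineCoordBlowup.𝓘Λ 4 K (insert 0 (Fin.succ '' (S : Set (Fin 4)))) with hC₀
  set B := blowup.π C₀ with hBdef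
  have hB : IsBlowup B C₀ := blowup.isBlowup _
  haveI : IsProper B := hB.isProper
  haveI : IsLocallyNoetherian (blowup C₀) := LocallyOfFiniteType.isLocallyNoetherian B
  -- typ-2's comparison isomorphism and model chart
  obtain ⟨ε, hsq, hC', hKEY⟩ := ChartDictionary.exists_iso_restrict_blowup_zigzag φ ψ _ Zc hZφ hπ hB
  have hK := hKEY M.ideal (hypSheaf p s.F) p hM
  obtain ⟨Θ, h, h0, hs, hc⟩ := ChartDictionary.controlledTransform_chart_eq_step p hj hbj s hperm hB
  haveI := isOpenImmersion_specMap_algEquiv Θ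
  obtain ⟨hread, -, hnext⟩ :=
    ChartDictionary.zigzag_chart_of_chart φ ψ M hmult s.F (CentreBlowup.step p S j b s).F Zc hsee hT hB ε hsq hC' hK
      hj hbj h0 hs hc
  obtain ⟨hsee'', hclosed''⟩ := hnext S'' hsub
  -- the zigzag chart of the chart
  set φ₀ : P 4 K ⟶ blowup C₀ := Spec.map (CommRingCat.ofHom (Θ : A 4 K →+* A 4 K)) ≫
    AffineCoordBlowup.chartImm hB (ChartDictionary.succ_mem_centreVars hj) with hφ₀
  set φ'' := (φ₀ ∣_ (B ⁻¹ᵁ ψ.opensRange)) ≫ ε.inv ≫ (π ⁻¹ᵁ φ.opensRange).ι with hφ''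
  set ψ'' := (φ₀ ⁻¹ᵁ (B ⁻¹ᵁ ψ.opensRange)).ι with hψ''
  haveI : IsOpenImmersion φ₀ := by rw [hφ₀]; infer_instance
  haveI : IsOpenImmersion φ'' := by rw [hφ'']; infer_instance
  set c'' : Closeds W := closureImage φ'' ((((AffineCoordBlowup.𝓘Λ 4 K
    (insert 0 (Fin.succ '' (S'' : Set (Fin 4))))).comap ψ'').support : Set (φ₀ ⁻¹ᵁ (B ⁻¹ᵁ ψ.opensRange)))) with hc''
  have hcoe : (c'' : Set W) = φ'' '' (ψ'' ⁻¹'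
      (AffineCoordBlowup.CΛ 4 K (insert 0 (Fin.succ '' (S'' : Set (Fin 4)))) : Set (P 4 K))) := by
    rw [hc'', coe_closureImage, ChartDictionary.coe_support_comap_𝓘Λ ψ'', hclosed''.closure_eq]
  -- the propagated shape and FC-1
  obtain ⟨idx₂, cst₂, hshape₂, hinj₂⟩ :=
    ChartDictionary.shapeT_transform_zigzag φ ψ ε Zc hB hsq hC' hj hbj hs hsub idx cst hshape hinj
  have hE₂ : HasSNC (M.transform π Zc).boundary := MarkedIdeal.hasSNC_transform_boundary M hsncZ hπ
  have hEc₂ : HasSNCWith ((M.transform π Zc).boundary.map (·.comap φ''))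
      ((AffineCoordBlowup.𝓘Λ 4 K (insert 0 (Fin.succ '' (S'' : Set (Fin 4))))).comap ψ'') :=
    ChartDictionary.hasSNCWith_comap_of_shapeT_zigzag φ'' ψ'' hE₂ idx₂ cst₂ hshape₂ hinj₂
  refine ⟨c'', _, φ'', ψ'', inferInstance, inferInstance, hread,
    by rw [hc'']; exact ChartDictionary.comap_globalCentre_zigzag φ'' ψ'' _,
    by rw [hcoe]; exact Set.image_subset_range _ _, hsee'',
    ChartDictionary.isRegular_globalCentre_zigzag φ'' ψ'' hclosed'',
    ChartDictionary.hasSNCWith_globalCentre_zigzag φ'' ψ'' hclosed'' hE₂ hEc₂, ⟨idx₂, cst₂, hshape₂, hinj₂⟩, ?_⟩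
  rw [hcoe]
  exact ChartDictionary.image_next_centre_subset_preimage_zigzag φ ψ ε hB hsq hj hbj hs hsub

end Child

end Equimultiple

end Summit.ResolutionOfSingularities.ResolutionOfSingularities.Theorems.PIDim4

end
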